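import Mathlib.Algebra.BigOperators.Ring.Finset
import Mathlib.Data.Fintype.Sigma
import Mathlib.Data.Fintype.Sum
import Mathlib.Data.Fintype.BigOperators
import Literature.Computability.Complexity.ACVecOver
import HarnessLib

/-!
# Threshold gadgets over the `TC` basis: weighted thresholds, exact values and symmetric
predicates of small weighted sums

The tree's `TC⁰` basis `tcBasis = acBasis ∪ {MAJₖ | k}` (`ConstantDepth.lean`; Vollmer 1999,
§4.5.2, Def. 4.34) has MAJORITY gates only. Unit-weight threshold functions
`T^n_m = [∑ aᵢ ≥ m]` are majority gates padded with constants (Vollmer 1999, §1.4.1, proof of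
Thm. 1.37: `T^n_m = maj^{2n-2m}(a, 1, …, 1)` for `m < n/2`, `= maj^{2m}(a, 0, …, 0)` otherwise),
and small natural WEIGHTS are obtained by feeding an input to the gate several times (folklore;
Vollmer 1999, hint to Exercise 3.6; Siu–Roychowdhury–Kailath 1995, Ch. 3). Exact values and
arbitrary symmetric predicates of a count then follow as in the reduction `BCOUNT ≤cd MAJ` of
the same proof (`[x = r] = [x ≥ r] ∧ ¬[x ≥ r+1]`, and bit `j` of the count as the `∨` over the
hard-wired set `R_j` of admissible values). This file makes these remarks formal in the
realizability calculus `ACRealOver` / `ACVecOver`: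

* `acRealOver_wsum_ge` — for weights `c : α → ℕ` and a threshold `θ`, the predicate
  `[θ ≤ ∑ₐ cₐ·yₐ]` of the inputs `y : α → Bool` is realized over `tcBasis` at depth `2` with
  `≤ 2(∑ c + θ) + 2` gates: ONE majority gate reading input `a` with multiplicity `cₐ`, padded
  with constant inputs (`∧₀ = 1`, `∨₀ = 0`);
* `acRealOver_wsum_eq` — `[∑ₐ cₐ·yₐ = v]` at depth `3` (an `∧` of two thresholds);
* `acRealOver_wsum_pred` — ANY predicate `P (∑ₐ cₐ·yₐ)` of a weighted sum known to be `< R`,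
  at depth `4` with `O(R · (∑ c + R))` gates (an `∨` of exact-value tests over the hard-wired set
  of admissible values): residues `mod p`, parity, the bits of the count, comparisons;
* `acVecOver_wsum_oneHot` — the ONE-HOT layer `([∑ c·y = v])_{v < R}`;
* the layered forms `ACVecOver.wsumPred` / `ACVecOver.wsumOneHot` (the weighted sum is taken over
  the output wires of an already realized shared layer; depths add `+4`/`+3`, sizes add), and the
  one-hot bookkeeping `wsum_oneHotWires` (a weighted sum over one-hot groups is `∑ᵢ ℓᵢ(selᵢ)`),
  `acRealOver_selectBit` (reading a table bit addressed by a one-hot group is one `∨` gate).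

All statements are proved. Mathlib has no Boolean circuits.

## References

* H. Vollmer, *Introduction to Circuit Complexity* (1999), §1.4.1, proof of Thm. 1.37
  (threshold functions from majority by padding with constants; `[x = r] = T_r ∧ ¬T_{r+1}`;
  `BCOUNT` as an `∨` over hard-wired value sets), hint to Exercise 3.6 (weights), §4.5.2,
  Def. 4.34 (`TC⁰`).
* K.-Y. Siu, V. Roychowdhury, T. Kailath, *Discrete Neural Computation* (1995), Ch. 3 (small
  weights, symmetric functions by threshold circuits).
-/

namespace Literature.Computability.Complexity

open Finset GateList

variable {ι α β : Type*}

/-! ### The `TC` basis -/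

/-- `MAJₖ ∈ tcBasis`. [folklore] -/
theorem maj_mem_tcBasis (k : ℕ) : GateFn.maj k ∈ tcBasis :=
  Set.mem_union_right _ (Set.mem_iUnion.2 ⟨k, rfl⟩)

/-- `¬ ∈ tcBasis`. [folklore] -/
theorem not_mem_tcBasis : GateFn.not ∈ tcBasis := acBasis_subset_tcBasis mem_acBasis_not

/-! ### Weighted sums of Boolean inputs -/

/-- The weighted sum `∑ₐ cₐ · [yₐ]` of Boolean inputs with natural weights. [cite: Vollmer1999, §1.4.1 (threshold functions `T^n_m`)] -/
def wsum [Fintype α] (c : α → ℕ) (y : α → Bool) : ℕ := ∑ a, c a * (y a).toNat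

/-- The weighted sum is at most the total weight. [folklore] -/
theorem wsum_le [Fintype α] (c : α → ℕ) (y : α → Bool) : wsum c y ≤ ∑ a, c a := by
  unfold wsum
  refine Finset.sum_le_sum fun a _ => ?_
  cases y a <;> simp

/-- Unit weights count the true inputs. [folklore] -/
theorem wsum_one [Fintype α] (y : α → Bool) : wsum (fun _ => 1) y = #{a | y a = true} := by
  unfold wsum
  rw [Finset.card_filter]
  refine Finset.sum_congr rfl fun a _ => ?_
  cases y a <;> simp

/-! ### One majority gate with copied and constant inputs -/

section MajPad

variable [Fintype α]

/-- The index type of the argument slots of the padded majority gate: `cₐ` copies of input `a`,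
and `pad` constant slots. [folklore] -/
abbrev MajSlots (c : α → ℕ) (pad : ℕ) : Type _ := (Σ a : α, Fin (c a)) ⊕ Fin pad

/-- The Boolean function read at a slot: an input literal or the padding constant `b`. [folklore] -/
def slotFn (c : α → ℕ) (pad : ℕ) (b : Bool) : MajSlots c pad → (α → Bool) → Bool
  | Sum.inl σ => fun y => y σ.1
  | Sum.inr _ => fun _ => b

/-- Counting the true slots: `∑ₐ cₐ [yₐ] + pad·[b]`. [folklore] -/
theorem sum_slotFn_toNat (c : α → ℕ) (pad : ℕ) (b : Bool) (y : α → Bool) :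
    (∑ w : MajSlots c pad, (slotFn c pad b w y).toNat) = wsum c y + pad * b.toNat := by
  rw [Fintype.sum_sum_type]
  congr 1
  · rw [Fintype.sum_sigma]
    unfold wsum
    refine Finset.sum_congr rfl fun a _ => ?_
    simp [slotFn]
  · simp [slotFn]

/-- **One padded majority gate**: `[∑ c + pad ≤ 2 · (∑ₐ cₐ[yₐ] + pad·[b])]` is realized over
`tcBasis` at depth `2` with `∑ c + pad + 1` gates (the gate `MAJ_{∑ c + pad}` reading `cₐ` copies
of input `a` and `pad` copies of the constant `b`). [cite: Vollmer1999, §1.4.1, proof of Thm. 1.37 (`T^n_m = maj` padded with constants; weights by copying inputs: folklore, hint to Exercise 3.6)] -/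
theorem acRealOver_majPad (c : α → ℕ) (pad : ℕ) (b : Bool) :
    ACRealOver tcBasis
      (fun y : α → Bool => decide ((∑ a, c a) + pad ≤ 2 * (wsum c y + pad * b.toNat))) 2
      ((∑ a, c a) + pad + 1) := by
  classical
  set k := Fintype.card (MajSlots c pad) with hk
  have hkval : k = (∑ a, c a) + pad := by
    rw [hk, Fintype.card_sum, Fintype.card_sigma]
    simp
  set e := Fintype.equivFin (MajSlots c pad) with he
  -- the argument blocks
  let f : Fin k → (α → Bool) → Bool := fun j => slotFn c pad b (e.symm j)
  have hf : ∀ j, ACRealOver tcBasis (f j) 1 1 := by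
    intro j
    change ACRealOver tcBasis (slotFn c pad b (e.symm j)) 1 1
    cases e.symm j with
    | inl σ => exact (acRealOver_input tcBasis σ.1).mono zero_le_one zero_le_one
    | inr _ => exact acRealOver_const acBasis_subset_tcBasis b
  have hg := acRealOver_gate (B := tcBasis) (GateFn.maj k) (maj_mem_tcBasis k) (s := fun _ => 1) hf
  simp only [Finset.sum_const, Finset.card_univ, Fintype.card_fin, smul_eq_mul, mul_one] at hg
  refine (hg.congr fun y => ?_).mono le_rfl (by rw [hkval]; exact le_rfl)
  -- semantics of the majority gate
  change decide (k ≤ 2 * GateFn.numOnes fun j => f j y) = _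
  have hcount : GateFn.numOnes (fun j => f j y) = wsum c y + pad * b.toNat := by
    unfold GateFn.numOnes
    have h1 : #{j : Fin k | f j y = true} = #{w : MajSlots c pad | slotFn c pad b w y = true} := by
      refine Finset.card_equiv e.symm fun j => ?_
      simp [f]
    rw [h1, Finset.card_filter, ← sum_slotFn_toNat c pad b y]
    refine Finset.sum_congr rfl fun w _ => ?_
    cases slotFn c pad b w y <;> simp
  rw [hcount, hkval]

end MajPad

/-! ### Weighted threshold, exact value, arbitrary predicates of a small weighted sum -/

section Wsum

variable [Fintype α]

/-- **Weighted threshold by one majority gate**: `[θ ≤ ∑ₐ cₐ·yₐ]` is realized over `tcBasis`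
at depth `2` with at most `2(∑ c + θ) + 2` gates. [cite: Vollmer1999, §1.4.1, proof of Thm. 1.37 (`T^n_m = maj^{2n-2m}(a,1,…,1)` / `maj^{2m}(a,0,…,0)`; weights by copying inputs: folklore, hint to Exercise 3.6)] -/
theorem acRealOver_wsum_ge (c : α → ℕ) (θ : ℕ) :
    ACRealOver tcBasis (fun y : α → Bool => decide (θ ≤ wsum c y)) 2 (2 * ((∑ a, c a) + θ) + 2) := by
  set C := ∑ a, c a with hC
  rcases Nat.eq_zero_or_pos θ with rfl | hθ
  · refine ((acRealOver_const acBasis_subset_tcBasis true).congr fun y => ?_).mono one_le_two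
      (by omega)
    simp
  by_cases hcase : C + 1 ≤ 2 * θ
  · -- pad with `2θ - 1 - C` zeros
    have h := acRealOver_majPad c (2 * θ - 1 - C) false
    refine (h.congr fun y => ?_).mono le_rfl (by omega)
    simp only [Bool.toNat_false, mul_zero, add_zero, decide_eq_decide]
    rw [← hC]
    omega
  · -- pad with `C + 1 - 2θ` ones
    have h := acRealOver_majPad c (C + 1 - 2 * θ) true
    refine (h.congr fun y => ?_).mono le_rfl (by omega)
    simp only [Bool.toNat_true, mul_one, decide_eq_decide]
    rw [← hC]
    omega

/-- **Exact value of a weighted sum**: `[∑ₐ cₐ·yₐ = v]` at depth `3` with at most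
`4(∑ c + v) + 11` gates (`[≥ v] ∧ ¬[≥ v+1]`). [cite: Vollmer1999, §1.4.1, proof of Thm. 1.37 (`[x = r] = [x ≥ r] ∧ ¬[x ≥ r+1]`)] -/
theorem acRealOver_wsum_eq (c : α → ℕ) (v : ℕ) :
    ACRealOver tcBasis (fun y : α → Bool => decide (wsum c y = v)) 3 (4 * ((∑ a, c a) + v) + 11) := by
  have h1 : ACRealOver tcBasis (fun y : α → Bool => decide (v ≤ wsum c y)) 2
      (2 * ((∑ a, c a) + v + 1) + 3) :=
    (acRealOver_wsum_ge c v).mono le_rfl (by omega)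
  have h2 : ACRealOver tcBasis (fun y : α → Bool => !decide (v + 1 ≤ wsum c y)) 2
      (2 * ((∑ a, c a) + v + 1) + 3) :=
    ((acRealOver_wsum_ge c (v + 1)).neg not_mem_tcBasis).mono le_rfl (by omega)
  let fam : Fin 2 → (α → Bool) → Bool :=
    Fin.cons (fun y => decide (v ≤ wsum c y)) (fun _ y => !decide (v + 1 ≤ wsum c y))
  have hfam : ∀ j, ACRealOver tcBasis (fam j) 2 (2 * ((∑ a, c a) + v + 1) + 3) := by
    intro j
    refine Fin.cases ?_ (fun j => ?_) j
    · simpa [fam] using h1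
    · fin_cases j; simpa [fam] using h2
  refine ((acRealOver_forall_const acBasis_subset_tcBasis hfam).congr fun y => ?_).mono le_rfl
    (by omega)
  have key : (∀ j, fam j y = true) ↔ wsum c y = v := by
    simp only [Fin.forall_fin_two]
    simp only [fam, Fin.cons_zero, Fin.cons_one, decide_eq_true_eq, Bool.not_eq_true',
      decide_eq_false_iff_not, not_le]
    omega
  exact decide_eq_decide.2 key

/-- **Any predicate of a small weighted sum** ("symmetric functions are in constant-depth
`TC⁰`"): if `∑ c < R` then `[P (∑ₐ cₐ·yₐ)]` is realized over `tcBasis` at depth `4` with at most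
`R · (4(∑ c + R) + 11) + 1` gates, for every decidable `P` — the `∨` over the values `v < R` with
`P v` of the exact-value tests. [cite: Vollmer1999, §1.4.1, proof of Thm. 1.37 (`BCOUNT ≤cd MAJ`: the `∨` over the hard-wired set `R_j`)] -/
theorem acRealOver_wsum_pred (c : α → ℕ) {R : ℕ} (hR : (∑ a, c a) < R) (P : ℕ → Prop)
    [DecidablePred P] :
    ACRealOver tcBasis (fun y : α → Bool => decide (P (wsum c y))) 4
      (R * (4 * ((∑ a, c a) + R) + 11) + 1) := by
  set C := ∑ a, c a with hC
  -- the exact-value blocks, indexed by the admissible values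
  let V : Type := {v : Fin R // P v}
  have hblk : ∀ w : V, ACRealOver tcBasis (fun y : α → Bool => decide (wsum c y = w.1)) 3
      (4 * (C + R) + 11) := fun w =>
    (acRealOver_wsum_eq c w.1).mono le_rfl (by have := w.1.2; omega)
  have hex := acRealOver_exists_const acBasis_subset_tcBasis
    (f := fun (j : Fin (Fintype.card V)) y => decide (wsum c y = ((Fintype.equivFin V).symm j).1))
    (fun j => hblk _)
  have hcard : Fintype.card V ≤ R := (Fintype.card_subtype_le _).trans (by simp)
  refine (hex.congr fun y => ?_).mono le_rfl (Nat.succ_le_succ (Nat.mul_le_mul_right _ hcard))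
  have hlt : wsum c y < R := (wsum_le c y).trans_lt hR
  simp only [decide_eq_true_eq, decide_eq_decide]
  constructor
  · rintro ⟨j, hj⟩
    rw [hj]
    exact ((Fintype.equivFin V).symm j).2
  · intro hP
    refine ⟨Fintype.equivFin V ⟨⟨wsum c y, hlt⟩, hP⟩, ?_⟩
    simp

/-- **The one-hot layer of a small weighted sum**: the family `([∑ₐ cₐ·yₐ = v])_{v < R}` is
realized over `tcBasis` at depth `3` with at most `R · (4(∑ c + R) + 11)` gates; exactly one
output is true when `∑ c < R`. [cite: Vollmer1999, §1.4.1, proof of Thm. 1.37] -/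
theorem acVecOver_wsum_oneHot (c : α → ℕ) (R : ℕ) :
    ACVecOver tcBasis (fun (y : α → Bool) (v : Fin R) => decide (wsum c y = v)) 3
      (R * (4 * ((∑ a, c a) + R) + 11)) := by
  have h := acVecOver_ofBlocks_const (B := tcBasis)
    (f := fun (v : Fin R) (y : α → Bool) => decide (wsum c y = v)) (d := 3)
    (s := 4 * ((∑ a, c a) + R) + 11) fun v =>
      (acRealOver_wsum_eq c v).mono le_rfl (by have := v.2; omega)
  exact h

end Wsum

/-! ### Layered forms: weighted sums over the outputs of a shared layer -/

namespace ACVecOver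

variable [Fintype α] {f : (ι → Bool) → α → Bool} {d s : ℕ}

/-- A predicate of a small weighted sum of the OUTPUT WIRES of a realized layer: depth `d + 4`,
size `s + R(4(∑ c + R) + 11) + 1`. [cite: Vollmer1999, §1.4.1, proof of Thm. 1.37, and §1.2 (composition)] -/
theorem wsumPred (h : ACVecOver tcBasis f d s) (c : α → ℕ) {R : ℕ} (hR : (∑ a, c a) < R)
    (P : ℕ → Prop) [DecidablePred P] :
    ACRealOver tcBasis (fun x => decide (P (wsum c (f x)))) (4 + d)
      (R * (4 * ((∑ a, c a) + R) + 11) + 1 + s) :=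
  (acRealOver_wsum_pred c hR P).compVec h

/-- A threshold of a weighted sum of the output wires of a realized layer: depth `d + 2`. [cite: Vollmer1999, §1.4.1, proof of Thm. 1.37] -/
theorem wsumGe (h : ACVecOver tcBasis f d s) (c : α → ℕ) (θ : ℕ) :
    ACRealOver tcBasis (fun x => decide (θ ≤ wsum c (f x))) (2 + d)
      (2 * ((∑ a, c a) + θ) + 2 + s) :=
  (acRealOver_wsum_ge c θ).compVec h

/-- The one-hot layer of a weighted sum of the output wires of a realized layer: depth `d + 3`. [cite: Vollmer1999, §1.4.1, proof of Thm. 1.37] -/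
theorem wsumOneHot (h : ACVecOver tcBasis f d s) (c : α → ℕ) (R : ℕ) :
    ACVecOver tcBasis (fun x (v : Fin R) => decide (wsum c (f x) = v)) (3 + d)
      (R * (4 * ((∑ a, c a) + R) + 11) + s) :=
  (acVecOver_wsum_oneHot c R).comp h

end ACVecOver

/-! ### One-hot groups: weighted sums and table look-up -/

/-- The one-hot wires of a family of selectors: wire `(i, ρ)` carries `[selᵢ x = ρ]`. [folklore] -/
def oneHotWires {R : ℕ} (sel : (ι → Bool) → β → Fin R) (x : ι → Bool) (p : β × Fin R) : Bool :=
  decide (sel x p.1 = p.2)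

/-- `oneHotWires` unfolds. [folklore] -/
@[simp] theorem oneHotWires_apply {R : ℕ} (sel : (ι → Bool) → β → Fin R) (x : ι → Bool) (i : β)
    (ρ : Fin R) : oneHotWires sel x (i, ρ) = decide (sel x i = ρ) := rfl

/-- **A weighted sum over one-hot groups is a sum of table entries**: with weights `ℓ (i, ρ)`,
`∑_{(i,ρ)} ℓ(i,ρ)·[selᵢ x = ρ] = ∑ᵢ ℓ(i, selᵢ x)`. [folklore] -/
theorem wsum_oneHotWires [Fintype β] {R : ℕ} (ℓ : β × Fin R → ℕ) (sel : (ι → Bool) → β → Fin R)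
    (x : ι → Bool) : wsum ℓ (oneHotWires sel x) = ∑ i, ℓ (i, sel x i) := by
  unfold wsum
  rw [Fintype.sum_prod_type]
  refine Finset.sum_congr rfl fun i _ => ?_
  rw [Finset.sum_eq_single (sel x i)]
  · simp
  · intro ρ _ hρ
    simp [oneHotWires, Ne.symm hρ]
  · simp

/-- **Table look-up addressed by a one-hot group is one `∨` gate**: for a Boolean table
`tbl : Fin R → Bool`, the function `y ↦ ⋁_{ρ : tbl ρ} y_ρ` of the wires `y : Fin R → Bool` is
realized over any `B ⊇ acBasis` at depth `1` with one gate, and on the one-hot code of `v` it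
returns `tbl v` (`selectBit_oneHot`). [folklore] -/
theorem acRealOver_selectBit {B : Set GateFn} (hB : acBasis ⊆ B) {R : ℕ} (tbl : Fin R → Bool) :
    ACRealOver B (fun y : Fin R → Bool => decide (∃ ρ : {ρ : Fin R // tbl ρ = true}, y ρ.1 = true))
      1 1 := by
  let V : Type := {ρ : Fin R // tbl ρ = true}
  have hex := acRealOver_exists_const hB
    (f := fun (j : Fin (Fintype.card V)) (y : Fin R → Bool) => y ((Fintype.equivFin V).symm j).1)
    (d := 0) (s := 0) fun j => acRealOver_input B _
  have hcard : Fintype.card V ≤ R := (Fintype.card_subtype_le _).trans (by simp)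
  refine (hex.congr fun y => ?_).mono le_rfl (by simp)
  simp only [decide_eq_decide]
  constructor
  · rintro ⟨j, hj⟩; exact ⟨_, hj⟩
  · rintro ⟨ρ, hρ⟩; exact ⟨Fintype.equivFin V ρ, by simpa using hρ⟩

/-- Semantics of the look-up on a one-hot code: the selected table bit. [folklore] -/
theorem selectBit_oneHot {R : ℕ} (tbl : Fin R → Bool) (v : Fin R) :
    decide (∃ ρ : {ρ : Fin R // tbl ρ = true}, decide (v = ρ.1) = true) = tbl v := by
  cases htv : tbl v
  · simp only [decide_eq_false_iff_not, not_exists, decide_eq_true_eq]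
    rintro ⟨ρ, hρ⟩ rfl
    simp [htv] at hρ
  · simp only [decide_eq_true_eq]
    exact ⟨⟨v, htv⟩, rfl⟩

/-- **Reading table bits off a family of one-hot groups** (layered form): given a realized layer
whose wires `(i, ρ)` are the one-hot codes `[selᵢ x = ρ]` and Boolean tables `tbl k`, addressed by
the group `grp k`, the family `x ↦ (tbl k (sel x (grp k)))ₖ` is realized at depth `d + 1` with
`card γ + s` gates. [folklore] -/
theorem ACVecOver.selectBits {B : Set GateFn} (hB : acBasis ⊆ B) [Fintype β] {γ : Type*} [Fintype γ]
    {R : ℕ} {sel : (ι → Bool) → β → Fin R} {d s : ℕ}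
    (h : ACVecOver B (oneHotWires sel) d s) (grp : γ → β) (tbl : γ → Fin R → Bool) :
    ACVecOver B (fun x k => tbl k (sel x (grp k))) (1 + d) (Fintype.card γ + s) := by
  have hout : ∀ k, ACRealOver B
      (fun y : β × Fin R → Bool => decide (∃ ρ : {ρ : Fin R // tbl k ρ = true}, y (grp k, ρ.1) = true))
      1 1 := fun k =>
    (acRealOver_selectBit hB (tbl k)).rewire (fun ρ : Fin R => ((grp k, ρ) : β × Fin R))
  have hlayer := (acVecOver_ofBlocks_fintype_const hout).mono le_rfl (le_of_eq (mul_one _))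
  refine ((hlayer.comp h).congr fun x k => ?_)
  simp only [oneHotWires_apply]
  exact selectBit_oneHot (tbl k) (sel x (grp k))

end Literature.Computability.Complexity
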